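import Summits.CriticalPhenomena.PercolationContinuityZ3.Theorems.PercNearOneGluingNoHeavyLowerTailMajorityGluingThreeOfFourWZero
import Summits.CriticalPhenomena.PercolationContinuityZ3.Theorems.PercNearOneGluingNoHeavyLowerTailMajorityGluingSixHarris
import HarnessLib

/-!
# Majority gluing at `|A| = 6`: loss `(2 + δ₀^{2−√3})·δ₀` — `C(6) ≤ 2 + δ₀^{2−√3}` in the kernel (lane prim-rate, constants-miner 1, gen 31; CANDIDATES §GEN-20 R185, BENCH l.204 M1-W0)

Support file for the closed crux `NoHeavyLowerTail` (stmt-CriticalPhenomena-4575), majority-gluing line.  The `|A| = 6` assembly of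
`…MajorityGluingSixHarris` (`μ(H_a) ≤ δ_c + (1 − δ_c)·μ(≥ 3 of the four other relays cut)`, Harris) fed with PROPOSITION W₀
(`PropW0.threeOfFour_W0`: `μ(≥ 3 of 4 cut) ≤ M + M^{3−√3}`, now a kernel percolation theorem) instead of the van den Berg–Kahn bound `(256/243)·M`,
and the arithmetic `WindowBelow.gluingLoss_le'`, give for every weight function, observer `o`, hub `a₀ ∈ A`, `|A| = 6` and `δ₀ ≥ max_{a∈A} μ(a ↮ a₀)`:
  **`μ(o ↔ A) − μ(o ↔ a₀ ∧ 2N > 6) ≤ (2 + δ₀^{2−√3})·δ₀`**   (`majorityGluing_card_six_W0`),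
i.e. **`C(6) ≤ 2 + δ₀^{2 − √3}`** — the first KERNEL bound on the majority-gluing constant at `|A| = 6` that tends to the conjectured value `2`
as `δ₀ → 0` (the tree had `min(499/243, 1 + (256/243)(1 − δ₀))`, p315087 / p317879, and `2` only for `δ₀ ≥ 13/256`).  It is below the van den
Berg–Kahn constant exactly when `δ₀^{2−√3} + (256/243)δ₀ ≤ 13/243` (`WindowBelow.beats_vdBK_constant`).  Closure over degenerate weights by
continuity (`weights_le_of_forall_pos_lt_one`) as in the Harris file.  No definitions, no named facts, no sorries.
[cite: VandenbergHaggstromKahn2005, Thm. 1.3 (p. 6)] [cite: KozmaNitzan2024, Conj. 1 (p. 3)]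
-/

noncomputable section

namespace Summit.CriticalPhenomena.PercolationContinuityZ3.Theorems

open MeasureTheory Set
open Literature.Probability.LatticeModels (prodBernoulli prodBernoulli_real_continuous weights_le_of_forall_pos_lt_one)
open Literature.Probability.Percolation
open scoped Classical

namespace HubOnly
namespace PropW0

variable {n : ℕ}

/-- **Hub event at `|A| = 6`, non-degenerate weights, with Harris and W₀:** `μ(H_a) ≤ (2 + M^{2−√3})·M`, `M = max_{a'∈A} μ(a' ↮ a₀)`.
[cite: VandenbergHaggstromKahn2005, Thm. 1.3 (p. 6)] -/
theorem hubEvent_card_six_W0 (p : Sym2 (Fin n) → unitInterval) (A : Finset (Fin n)) (a₀ a : Fin n)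
    (ha₀ : a₀ ∈ A) (ha : a ∈ A) (hA : A.card = 6) :
    (prodBernoulli p).real {ω : BondConfig (Fin n) | ω ∈ openConn a a₀ →
        2 * (A.filter fun a' => ω ∈ openConn a' a₀).card ≤ A.card}
      ≤ (2 + A.sup' ⟨a₀, ha₀⟩ (fun a' => (prodBernoulli p).real (openConn a' a₀ : Set (BondConfig (Fin n)))ᶜ) ^ (2 - Real.sqrt 3)) *
        A.sup' ⟨a₀, ha₀⟩ (fun a' => (prodBernoulli p).real (openConn a' a₀ : Set (BondConfig (Fin n)))ᶜ) := by
  set μ := prodBernoulli p with hμ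
  have hms : ∀ S : Set (BondConfig (Fin n)), MeasurableSet S := fun _ => MeasurableSet.of_discrete
  set δ : Fin n → ℝ := fun x => μ.real (openConn x a₀ : Set (BondConfig (Fin n)))ᶜ with hδ
  set M := A.sup' ⟨a₀, ha₀⟩ δ with hM
  have hδle : ∀ x ∈ A, δ x ≤ M := fun x hx => Finset.le_sup' δ hx
  have hM0 : 0 ≤ M := le_trans measureReal_nonneg (hδle a₀ ha₀)
  have hM1 : M ≤ 1 := Finset.sup'_le _ _ fun x _ => measureReal_le_one
  -- the auxiliary relay `c ≠ a₀`
  obtain ⟨c, hcA, hca₀, hca⟩ : ∃ c ∈ A, c ≠ a₀ ∧ (a ≠ a₀ → c = a) := by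
    by_cases haa : a = a₀
    · have hpos : 1 < A.card := by rw [hA]; norm_num
      obtain ⟨c, hc, hne⟩ := Finset.exists_mem_ne hpos a₀
      exact ⟨c, hc, hne, fun h => (h haa).elim⟩
    · exact ⟨a, ha, haa, fun _ => rfl⟩
  set T : Finset (Fin n) := (A.erase a₀).erase c with hT
  have hcT : c ∈ A.erase a₀ := Finset.mem_erase.2 ⟨hca₀, hcA⟩
  have hTcard : T.card = 4 := by
    rw [hT, Finset.card_erase_of_mem hcT, Finset.card_erase_of_mem ha₀, hA]
  have hTA : T ⊆ A := (Finset.erase_subset _ _).trans (Finset.erase_subset _ _)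
  have ha₀T : a₀ ∉ T := fun h => Finset.notMem_erase a₀ A (Finset.mem_of_mem_erase h)
  set K : Set (BondConfig (Fin n)) := {ω | 3 ≤ (T.filter fun v => ω ∉ openConn v a₀).card} with hK
  -- `H_a ⊆ {c ↮ a₀} ∪ ({c ↔ a₀} ∩ K)` (as in the Harris file)
  have hsub : {ω : BondConfig (Fin n) | ω ∈ openConn a a₀ → 2 * (A.filter fun a' => ω ∈ openConn a' a₀).card ≤ A.card} ⊆
      (openConn c a₀ : Set (BondConfig (Fin n)))ᶜ ∪ ((openConn c a₀ : Set (BondConfig (Fin n))) ∩ K) := by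
    intro ω hω
    by_cases hcc : ω ∈ openConn c a₀
    · right
      refine ⟨hcc, ?_⟩
      have haa : ω ∈ openConn a a₀ := by
        by_cases h' : a = a₀
        · rw [h']; exact (SimpleGraph.Reachable.refl _ : (openGraph ω).Reachable a₀ a₀)
        · rw [← hca h']; exact hcc
      have hle := hω haa
      rw [hA] at hle
      have hsplit := Finset.card_filter_add_card_filter_not (s := A) (fun a' => ω ∈ openConn a' a₀)
      rw [hA] at hsplit
      have hcut : (A.filter fun a' => ¬ ω ∈ openConn a' a₀) ⊆ T.filter fun v => ω ∉ openConn v a₀ := by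
        intro x hx
        rw [Finset.mem_filter] at hx ⊢
        refine ⟨?_, hx.2⟩
        rw [hT, Finset.mem_erase, Finset.mem_erase]
        refine ⟨?_, ?_, hx.1⟩
        · rintro rfl; exact hx.2 hcc
        · rintro rfl; exact hx.2 (SimpleGraph.Reachable.refl _ : (openGraph ω).Reachable x x)
      have hc := Finset.card_le_card hcut
      simp only [hK, mem_setOf_eq]
      omega
    · left; exact hcc
  -- `μ(K) ≤ M + M^{3−√3}` (PROPOSITION W₀) and Harris
  have hKW : μ.real K ≤ M + M ^ (3 - Real.sqrt 3) := threeOfFour_W0 p a₀ T hTcard ha₀T M (fun v hv => hδle v (hTA hv))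
  have hHarris : μ.real ((openConn c a₀ : Set (BondConfig (Fin n))) ∩ K) ≤
      μ.real (openConn c a₀ : Set (BondConfig (Fin n))) * μ.real K :=
    Literature.Probability.LatticeModels.prodBernoulli_harris_upper_lower p (isUpperSet_openConn c a₀)
      (isLowerSet_thresholdCut T a₀ 3) (hms _) (hms _)
  have hconn : μ.real (openConn c a₀ : Set (BondConfig (Fin n))) = 1 - δ c := by
    have := probReal_compl_eq_one_sub (μ := μ) (hms (openConn c a₀ : Set (BondConfig (Fin n))))
    simp only [hδ]; linarith
  have hδc : δ c ≤ M := hδle c hcA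
  have hδc0 : 0 ≤ δ c := measureReal_nonneg
  have hK1 : μ.real K ≤ 1 := measureReal_le_one
  calc μ.real {ω : BondConfig (Fin n) | ω ∈ openConn a a₀ → 2 * (A.filter fun a' => ω ∈ openConn a' a₀).card ≤ A.card}
      ≤ μ.real ((openConn c a₀ : Set (BondConfig (Fin n)))ᶜ ∪ ((openConn c a₀ : Set (BondConfig (Fin n))) ∩ K)) :=
        measureReal_mono hsub
    _ ≤ μ.real (openConn c a₀ : Set (BondConfig (Fin n)))ᶜ + μ.real ((openConn c a₀ : Set (BondConfig (Fin n))) ∩ K) :=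
        measureReal_union_le _ _
    _ ≤ δ c + (1 - δ c) * μ.real K := by rw [← hconn]; exact add_le_add le_rfl hHarris
    _ ≤ (2 + M ^ (2 - Real.sqrt 3)) * M := WindowBelow.gluingLoss_le' hδc0 hδc hM0 le_rfl hM1 hK1 hKW

/-- `t ↦ (2 + t^{2−√3})·t` is monotone on `[0, ∞)`. [folklore] -/
theorem lossW0_mono {m d : ℝ} (hm0 : 0 ≤ m) (hmd : m ≤ d) :
    (2 + m ^ (2 - Real.sqrt 3)) * m ≤ (2 + d ^ (2 - Real.sqrt 3)) * d := by
  have hd0 : 0 ≤ d := hm0.trans hmd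
  have hα : 0 ≤ 2 - Real.sqrt 3 := le_of_lt WindowBelow.two_sub_sqrt3_pos
  have hpow : m ^ (2 - Real.sqrt 3) ≤ d ^ (2 - Real.sqrt 3) := Real.rpow_le_rpow hm0 hmd hα
  have hp0 : 0 ≤ d ^ (2 - Real.sqrt 3) := Real.rpow_nonneg hd0 _
  calc (2 + m ^ (2 - Real.sqrt 3)) * m ≤ (2 + d ^ (2 - Real.sqrt 3)) * m :=
        mul_le_mul_of_nonneg_right (by linarith) hm0
    _ ≤ (2 + d ^ (2 - Real.sqrt 3)) * d := mul_le_mul_of_nonneg_left hmd (by linarith)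

/-- **MAJORITY GLUING AT `|A| = 6` WITH LOSS `(2 + δ₀^{2−√3})·δ₀` — «`C(6) ≤ 2 + δ₀^{2−√3}`»** for every weight function, observer `o`,
hub `a₀ ∈ A` and `δ₀ ≥ max_{a∈A} μ(a ↮ a₀)`:  `μ(o ↔ A) − μ(o ↔ a₀ ∧ 2N > 6) ≤ (2 + δ₀^{2−√3})·δ₀`.  The first kernel bound on the `|A| = 6` loss
constant tending to `2` as `δ₀ → 0` (PROPOSITION W₀ + Harris + continuity in the weights).
[cite: VandenbergHaggstromKahn2005, Thm. 1.3 (p. 6)] [cite: KozmaNitzan2024, Conj. 1 (p. 3)] -/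
theorem majorityGluing_card_six_W0 (w : Sym2 (Fin n) → unitInterval) (A : Finset (Fin n)) (o a₀ : Fin n) (δ₀ : ℝ)
    (ha₀ : a₀ ∈ A) (hA : A.card = 6) (hδ₀ : ∀ a ∈ A, (prodBernoulli w).real (openConn a a₀ : Set (BondConfig (Fin n)))ᶜ ≤ δ₀) :
    (prodBernoulli w).real (⋃ a ∈ A, openConn o a) -
        (prodBernoulli w).real {ω : BondConfig (Fin n) | ω ∈ openConn o a₀ ∧
          A.card < 2 * (A.filter fun a => ω ∈ openConn o a).card}
      ≤ (2 + δ₀ ^ (2 - Real.sqrt 3)) * δ₀ := by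
  set f : (Sym2 (Fin n) → unitInterval) → ℝ := fun p =>
    (prodBernoulli p).real (⋃ a ∈ A, openConn o a) -
        (prodBernoulli p).real {ω : BondConfig (Fin n) | ω ∈ openConn o a₀ ∧
          A.card < 2 * (A.filter fun a => ω ∈ openConn o a).card} with hf
  set Mf : (Sym2 (Fin n) → unitInterval) → ℝ := fun p =>
    A.sup' ⟨a₀, ha₀⟩ (fun a' => (prodBernoulli p).real (openConn a' a₀ : Set (BondConfig (Fin n)))ᶜ) with hMf
  set g : (Sym2 (Fin n) → unitInterval) → ℝ := fun p => (2 + Mf p ^ (2 - Real.sqrt 3)) * Mf p with hg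
  have hfc : Continuous f := (prodBernoulli_real_continuous _).sub (prodBernoulli_real_continuous _)
  have hMc : Continuous Mf := Continuous.finset_sup'_apply _ fun a' _ => prodBernoulli_real_continuous _
  have hα : 0 ≤ 2 - Real.sqrt 3 := le_of_lt WindowBelow.two_sub_sqrt3_pos
  have hgc : Continuous g := (continuous_const.add ((Real.continuous_rpow_const hα).comp hMc)).mul hMc
  have hfg : ∀ p : Sym2 (Fin n) → unitInterval, (∀ e, 0 < p e ∧ p e < 1) → f p ≤ g p := by
    intro p hp
    obtain ⟨a, haA, hle⟩ := deficit_le_hubEvent p hp A o a₀ ha₀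
    exact hle.trans (hubEvent_card_six_W0 p A a₀ a ha₀ haA hA)
  have hw := weights_le_of_forall_pos_lt_one hfc hgc hfg w
  have hMw : Mf w ≤ δ₀ := Finset.sup'_le _ _ fun a' ha' => hδ₀ a' ha'
  have hMw0 : 0 ≤ Mf w := le_trans measureReal_nonneg (Finset.le_sup' (fun a' => (prodBernoulli w).real
    (openConn a' a₀ : Set (BondConfig (Fin n)))ᶜ) ha₀)
  calc f w ≤ g w := hw
    _ = (2 + Mf w ^ (2 - Real.sqrt 3)) * Mf w := rfl
    _ ≤ (2 + δ₀ ^ (2 - Real.sqrt 3)) * δ₀ := lossW0_mono hMw0 hMw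

/-- **`C(6) ≤ 2 + δ₀^{2−√3}` in the «loss-`C·δ₀`» form of the lane's table** (SUMMARY-M1-L2.md): `μ(o ↔ a₀ ∧ 2N > 6) ≥ μ(o ↔ A) − (2 + δ₀^{2−√3})·δ₀`.
With `…SixHarris` (`C(6) = 2` for `δ₀ ≥ 13/256`) the gap to the conjectured `C(6) = 2` is now `δ₀^{2−√3}·δ₀` on `(0, 13/256)` — e.g. loss `≤ 2.45·δ₀`
at `δ₀ = 13/256`, `≤ 2.16·δ₀` at `δ₀ = 10⁻³`, `≤ 2.025·δ₀` at `δ₀ = 10⁻⁶`. [cite: KozmaNitzan2024, Conj. 1 (p. 3)] -/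
theorem majorityGluing_card_six_W0' (w : Sym2 (Fin n) → unitInterval) (A : Finset (Fin n)) (o a₀ : Fin n) (δ₀ : ℝ)
    (ha₀ : a₀ ∈ A) (hA : A.card = 6) (hδ₀ : ∀ a ∈ A, (prodBernoulli w).real (openConn a a₀ : Set (BondConfig (Fin n)))ᶜ ≤ δ₀) :
    (prodBernoulli w).real (⋃ a ∈ A, openConn o a) - (2 + δ₀ ^ (2 - Real.sqrt 3)) * δ₀ ≤
      (prodBernoulli w).real {ω : BondConfig (Fin n) | ω ∈ openConn o a₀ ∧
          A.card < 2 * (A.filter fun a => ω ∈ openConn o a).card} := by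
  have := majorityGluing_card_six_W0 w A o a₀ δ₀ ha₀ hA hδ₀
  linarith

end PropW0
end HubOnly
end Summit.CriticalPhenomena.PercolationContinuityZ3.Theorems
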